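import Mathlib
import Literature.Probability.RandomPlanarGeometry.ChordalCurveFamily
import Literature.Probability.RandomPlanarGeometry.ChordalCurveFamilyProofs
import Literature.Topology.Euclidean.PlanarStaircase
import Summits.CriticalPhenomena.CardyFormulaZ2.Theorems.SymmetryUpgradeR.Negative.DiracChords
import HarnessLib

/-!
# Configuration rigidity for typical proper pasts

Crux `AxiomsOfLimit` (stmt-CriticalPhenomena-1370), line `registered`, stub `stub_markovOfLimit`,
domain bookkeeping D2 "configuration rigidity: (remaining domain, tip, target) determines
(carrier, start, past)" (lead c4); registered sub-stub `stub_configRigidity`. Theorems only.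

A *typical proper past* of a Dobrushin domain `(D; a, b)` is the class `p = mk γ` of an injective
curve `γ` with `γ 0 = a = D.pt 0` whose other points lie in the open carrier. Assuming the
arc-complement connectivity statement (hypothesis `hArc`, the neighbouring stub
`stub_arcComplementConnected`: `D ∖ γ` is connected), two typical proper pasts `(D₁, p₁)`,
`(D₂, p₂)` with the same remaining domain come from the same carrier, start at the same marked
point and are the same curve class. This is the well-definedness, on typical pasts, of a Markov
kernel defined through configurations (`ChordalFamily.IsMarkovExtension.domain`).

## The argument

For one typical pair, with `K = range γ`:
* `remainingDomain D p = D ∖ K` (`ConfigRigidity.remainingDomain_eq`): `D ∖ K` is connected by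
  `hArc`, and `D.pt 1` lies in its closure, being a frontier point of `D` off the compact arc;
* `K` has empty interior (`ConfigRigidity.interior_range_eq_empty`): a ball inside `K` pulls
  back under the embedding `γ` to a preconnected subset of `[0, 1]` with two points which stays
  preconnected after deleting any of its points (a planar domain minus a point is connected,
  `Literature.Topology.Euclidean.isPreconnected_diff_singleton`) — absurd on an interval;
  hence `closure (D ∖ K) = closure D`;
* `interior (closure D) = D` for a Jordan domain (a regular open set; the tree's
  `JordanDomain.interior_closure_carrier` of `SymmetryUpgradeR.Negative.DiracChords`).
So equal remaining domains `U` force `D₁ = interior (closure U) = D₂ =: D`, then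
`D ∩ K₁ = D ∖ U = D ∩ K₂ =: S`; the start `γ₂ 0` is a limit of `K₂ ∖ {γ₂ 0} ⊆ S ⊆ K₁` and a
frontier point of `D`, so it is the only frontier point `γ₁ 0` of `K₁`; thus `K₁ = S ∪ {γ₁ 0} = K₂`.
Finally `φ = γ₂⁻¹ ∘ γ₁` is a continuous bijection of `[0, 1]` fixing `0`, hence increasing
(`Continuous.strictMono_of_inj_boundedOrder`), so `γ₁ = γ₂.reparam φ` and `mk γ₁ = mk γ₂`.

Folklore plane topology (Newman, *Elements of the topology of plane sets of points* (1951),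
Ch. III–V). All `[folklore]`.
-/

noncomputable section

open Set Filter Topology Metric

namespace Summit.CriticalPhenomena.SAWScalingLimit.Theorems.AxiomsOfLimitMarkov

open Literature.Probability.RandomPlanarGeometry
open Summit.CriticalPhenomena.CardyFormulaZ2.Theorems.SymmetryUpgradeR.Negative
  (JordanDomain.interior_closure_carrier)

/-! ### Arcs are nowhere dense -/

/-- A preconnected subset `U` of `[0, 1]` which stays preconnected after deleting any one of its
points cannot contain two points `s₁ < s₂`: it would contain a point strictly between them, and
deleting that point separates `s₁` from `s₂`. [folklore] -/
theorem ConfigRigidity.not_lt_of_isPreconnected_sdiff {U : Set unitInterval}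
    (hU : IsPreconnected U) (h : ∀ m ∈ U, IsPreconnected (U \ {m})) {s₁ s₂ : unitInterval}
    (h₁ : s₁ ∈ U) (h₂ : s₂ ∈ U) (hlt : s₁ < s₂) : False := by
  have hlt' : (s₁ : ℝ) < s₂ := Subtype.coe_lt_coe.2 hlt
  -- a point of `U` strictly between `s₁` and `s₂`
  have hV₀ : IsPreconnected (((↑) : unitInterval → ℝ) '' U) :=
    hU.image _ continuous_subtype_val.continuousOn
  obtain ⟨m, hmU, hm⟩ : ((s₁ : ℝ) + s₂) / 2 ∈ ((↑) : unitInterval → ℝ) '' U :=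
    hV₀.Icc_subset (mem_image_of_mem _ h₁) (mem_image_of_mem _ h₂) ⟨by linarith, by linarith⟩
  have hm₁ : s₁ < m := Subtype.coe_lt_coe.1 (by rw [hm]; linarith)
  have hm₂ : m < s₂ := Subtype.coe_lt_coe.1 (by rw [hm]; linarith)
  -- deleting `m` keeps `s₁`, `s₂`, and the image in `ℝ` is still an interval
  have hV : IsPreconnected (((↑) : unitInterval → ℝ) '' (U \ {m})) :=
    (h m hmU).image _ continuous_subtype_val.continuousOn
  have hs₁ : (s₁ : ℝ) ∈ ((↑) : unitInterval → ℝ) '' (U \ {m}) :=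
    mem_image_of_mem _ ⟨h₁, fun h' => hm₁.ne (mem_singleton_iff.1 h')⟩
  have hs₂ : (s₂ : ℝ) ∈ ((↑) : unitInterval → ℝ) '' (U \ {m}) :=
    mem_image_of_mem _ ⟨h₂, fun h' => hm₂.ne' (mem_singleton_iff.1 h')⟩
  obtain ⟨u, ⟨-, hum⟩, hu⟩ : (m : ℝ) ∈ ((↑) : unitInterval → ℝ) '' (U \ {m}) :=
    hV.Icc_subset hs₁ hs₂ ⟨Subtype.coe_le_coe.2 hm₁.le, Subtype.coe_le_coe.2 hm₂.le⟩
  exact hum (mem_singleton_iff.2 (Subtype.ext hu))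

/-- **A simple arc is nowhere dense in the plane**: the trace of an injective curve has empty
interior. A ball inside the trace pulls back, under the embedding `γ`, to a preconnected subset
of `[0, 1]` with two points which stays preconnected after deleting any of its points (an open
connected planar set minus a point is connected), which is absurd. [folklore] -/
theorem ConfigRigidity.interior_range_eq_empty {γ : Curve ℂ} (hinj : Function.Injective γ) :
    interior γ.range = ∅ := by
  by_contra hne
  obtain ⟨z, hz⟩ := nonempty_iff_ne_empty.2 hne
  rw [mem_interior_iff_mem_nhds, Metric.mem_nhds_iff] at hz
  obtain ⟨r, hr, hB⟩ := hz
  have hind : IsInducing γ := (γ.continuous.isClosedEmbedding hinj).isInducing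
  -- two distinct points of the ball and their parameters
  have hz₁ : z ∈ ball z r := mem_ball_self hr
  have hz₂ : z + ((r / 2 : ℝ) : ℂ) ∈ ball z r := by
    rw [mem_ball, dist_eq_norm, add_sub_cancel_left, Complex.norm_real, Real.norm_eq_abs,
      abs_of_pos (half_pos hr)]
    exact half_lt_self hr
  obtain ⟨s₁, hs₁⟩ := hB hz₁
  obtain ⟨s₂, hs₂⟩ := hB hz₂
  have hne : s₁ ≠ s₂ := by
    intro h
    have h' : z + ((r / 2 : ℝ) : ℂ) = z := by rw [← hs₂, ← hs₁, h]
    have h'' : r / 2 = 0 := Complex.ofReal_eq_zero.1 (add_eq_left.1 h')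
    linarith
  -- the pulled-back ball
  set U : Set unitInterval := γ ⁻¹' ball z r with hUdef
  have himg : γ '' U = ball z r := image_preimage_eq_of_subset hB
  have hUpc : IsPreconnected U := by
    refine hind.isPreconnected_image.1 ?_
    rw [himg]
    exact (convex_ball z r).isPreconnected
  have hUm : ∀ m ∈ U, IsPreconnected (U \ {m}) := by
    intro m _
    refine hind.isPreconnected_image.1 ?_
    rw [image_sdiff hinj, himg, image_singleton]
    exact Literature.Topology.Euclidean.isPreconnected_diff_singleton isOpen_ball
      (convex_ball z r).isPreconnected (γ m)
  have hU₁ : s₁ ∈ U := by show γ s₁ ∈ ball z r; rw [hs₁]; exact hz₁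
  have hU₂ : s₂ ∈ U := by show γ s₂ ∈ ball z r; rw [hs₂]; exact hz₂
  rcases lt_or_gt_of_ne hne with h | h
  · exact ConfigRigidity.not_lt_of_isPreconnected_sdiff hUpc hUm hU₁ hU₂ h
  · exact ConfigRigidity.not_lt_of_isPreconnected_sdiff hUpc hUm hU₂ hU₁ h

/-- Removing a simple arc from an open planar set does not change its closure (arcs are nowhere
dense). [folklore] -/
theorem ConfigRigidity.closure_sdiff_range_eq {V : Set ℂ} (hV : IsOpen V) {γ : Curve ℂ}
    (hinj : Function.Injective γ) : closure (V \ γ.range) = closure V := by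
  refine (closure_mono Set.sdiff_subset).antisymm ?_
  have hd : Dense γ.rangeᶜ :=
    interior_eq_empty_iff_dense_compl.1 (ConfigRigidity.interior_range_eq_empty hinj)
  exact closure_minimal (hd.open_subset_closure_inter hV) isClosed_closure

/-- The starting point of an injective arc is a limit of its other points. [folklore] -/
theorem ConfigRigidity.apply_zero_mem_closure {γ : Curve ℂ} (hinj : Function.Injective γ) :
    γ 0 ∈ closure (γ.range \ {γ 0}) := by
  rw [Metric.mem_closure_iff]
  intro ε hε
  obtain ⟨δ, hδ, hδε⟩ := Metric.continuous_iff.1 γ.continuous 0 ε hε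
  have hpos : 0 < min (δ / 2) 1 := lt_min (half_pos hδ) one_pos
  obtain ⟨t, ht0, htδ⟩ : ∃ t : unitInterval, t ≠ 0 ∧ dist t 0 < δ := by
    refine ⟨⟨min (δ / 2) 1, hpos.le, min_le_right _ _⟩, fun h => ?_, ?_⟩
    · have h' : min (δ / 2) 1 = 0 := congrArg Subtype.val h
      linarith
    · have hd : dist (⟨min (δ / 2) 1, hpos.le, min_le_right _ _⟩ : unitInterval) 0 =
          |min (δ / 2) 1 - 0| := by
        rw [Subtype.dist_eq, Real.dist_eq]
        rfl
      rw [hd, sub_zero, abs_of_pos hpos]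
      exact (min_le_left _ _).trans_lt (half_lt_self hδ)
  refine ⟨γ t, ⟨⟨t, rfl⟩, fun h => ht0 (hinj (mem_singleton_iff.1 h))⟩, ?_⟩
  rw [dist_comm]
  exact hδε t htδ

/-! ### One typical proper past -/

/-- Points of the open carrier of a Jordan domain are off its frontier. [folklore] -/
theorem ConfigRigidity.notMem_frontier {D : JordanDomain} {z : ℂ} (hz : z ∈ D.carrier) :
    z ∉ frontier D.carrier := fun h =>
  (disjoint_interior_frontier (s := D.carrier)).le_bot ⟨by rwa [D.isOpen.interior_eq], h⟩

/-- For a typical proper past (an injective arc `γ` from `D.pt 0` whose other points lie in the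
carrier) the second marked point `D.pt 1` is off the arc. [folklore] -/
theorem ConfigRigidity.pt_one_notMem_range {D : DobrushinDomain} {γ : Curve ℂ}
    (h0 : γ 0 = D.pt 0) (hin : ∀ t : unitInterval, t ≠ 0 → γ t ∈ D.carrier) :
    D.pt 1 ∉ γ.range := by
  rintro ⟨t, ht⟩
  by_cases h : t = 0
  · rw [h, h0] at ht
    exact absurd (D.pt_injective ht) (by decide)
  · exact ConfigRigidity.notMem_frontier (hin t h) (by rw [ht]; exact D.pt_mem_frontier 1)

/-- **The remaining domain of a typical proper past is the whole slit domain** `D ∖ γ`: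
assuming arc-complement connectivity, `D ∖ γ` is connected, and `D.pt 1` lies in its closure
(it is a frontier point of `D` off the compact arc). [folklore] -/
theorem ConfigRigidity.remainingDomain_eq
    (hArc : ∀ (D : JordanDomain) (γ : Curve ℂ), Function.Injective γ →
      γ 0 ∈ frontier D.carrier → (∀ t : unitInterval, t ≠ 0 → γ t ∈ D.carrier) →
      IsConnected (D.carrier \ γ.range))
    {D : DobrushinDomain} {γ : Curve ℂ} (hinj : Function.Injective γ) (h0 : γ 0 = D.pt 0)
    (hin : ∀ t : unitInterval, t ≠ 0 → γ t ∈ D.carrier) :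
    remainingDomain D (CurveClass.mk γ) = D.carrier \ γ.range := by
  ext z
  simp only [remainingDomain, CurveClass.range_mk, mem_setOf_eq]
  refine ⟨fun h => h.1, fun hz => ⟨hz, ?_⟩⟩
  have hconn : IsConnected (D.carrier \ γ.range) :=
    hArc D.toJordanDomain γ hinj (by rw [h0]; exact D.pt_mem_frontier 0) hin
  have hsub : D.carrier \ γ.range ⊆ connectedComponentIn (D.carrier \ γ.range) z :=
    hconn.isPreconnected.subset_connectedComponentIn hz subset_rfl
  refine closure_mono hsub ?_
  have h1 : D.pt 1 ∉ γ.range := ConfigRigidity.pt_one_notMem_range h0 hin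
  have hcl : D.pt 1 ∈ closure D.carrier := frontier_subset_closure (D.pt_mem_frontier 1)
  have hmem := γ.isCompact_range.isClosed.isOpen_compl.inter_closure ⟨h1, hcl⟩
  rwa [← Set.sdiff_eq_compl_inter] at hmem

/-- The trace of a typical proper past splits as its part inside the carrier plus the starting
point. [folklore] -/
theorem ConfigRigidity.range_eq_inter_union {D : DobrushinDomain} {γ : Curve ℂ}
    (hin : ∀ t : unitInterval, t ≠ 0 → γ t ∈ D.carrier) :
    γ.range = D.carrier ∩ γ.range ∪ {γ 0} := by
  refine Subset.antisymm ?_ (union_subset inter_subset_right (singleton_subset_iff.2 ⟨0, rfl⟩))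
  rintro _ ⟨t, rfl⟩
  by_cases h : t = 0
  · exact Or.inr (by rw [h]; exact mem_singleton _)
  · exact Or.inl ⟨hin t h, t, rfl⟩

/-! ### The registered statement -/

/-- **Configuration rigidity for typical proper pasts** (crux `AxiomsOfLimit`, registered stub
`stub_configRigidity`). Assuming arc-complement connectivity (`hArc`), two typical proper pasts
— classes of injective arcs from the marked point `D.pt 0` whose other points lie in the open
carrier — with the same remaining domain (and the same tip and target point) come from the same
carrier, start at the same point and are the same curve class. [folklore] -/
theorem stub_configRigidity : (∀ (D : Literature.Probability.RandomPlanarGeometry.JordanDomain) (γ : Literature.Probability.RandomPlanarGeometry.Curve ℂ), Function.Injective γ → γ 0 ∈ frontier D.carrier → (∀ t : unitInterval, t ≠ 0 → γ t ∈ D.carrier) → IsConnected (D.carrier \ γ.range)) → ∀ (D₁ D₂ : Literature.Probability.RandomPlanarGeometry.DobrushinDomain) (p₁ p₂ : Literature.Probability.RandomPlanarGeometry.CurveClass ℂ), ((∃ γ : Literature.Probability.RandomPlanarGeometry.Curve ℂ, Function.Injective γ ∧ Literature.Probability.RandomPlanarGeometry.CurveClass.mk γ = p₁) ∧ (p₁).source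 = (D₁).pt 0 ∧ (p₁).target ∈ (D₁).carrier ∧ (∀ z ∈ (p₁).range, z ≠ (D₁).pt 0 → z ∈ (D₁).carrier)) → ((∃ γ : Literature.Probability.RandomPlanarGeometry.Curve ℂ, Function.Injective γ ∧ Literature.Probability.RandomPlanarGeometry.CurveClass.mk γ = p₂) ∧ (p₂).source = (D₂).pt 0 ∧ (p₂).target ∈ (D₂).carrier ∧ (∀ z ∈ (p₂).range, z ≠ (D₂).pt 0 → z ∈ (D₂).carrier)) → Literature.Probability.RandomPlanarGeometry.remainingDomain D₁ p₁ = Literature.Probability.RandomPlanarGeometry.remainingDomain D₂ p₂ → p₁.target = p₂.target → D₁.pt 1 = D₂.pt 1 → D₁.carrier = D₂.carrier ∧ D₁.pt 0 = D₂.pt 0 ∧ p₁ = p₂ := by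
  intro hArc D₁ D₂ p₁ p₂ hT₁ hT₂ hrem _ _
  obtain ⟨⟨γ₁, hinj₁, rfl⟩, hsrc₁, -, hrg₁⟩ := hT₁
  obtain ⟨⟨γ₂, hinj₂, rfl⟩, hsrc₂, -, hrg₂⟩ := hT₂
  have h0₁ : γ₁ 0 = D₁.pt 0 := by rw [← hsrc₁]; rfl
  have h0₂ : γ₂ 0 = D₂.pt 0 := by rw [← hsrc₂]; rfl
  have hin₁ : ∀ t : unitInterval, t ≠ 0 → γ₁ t ∈ D₁.carrier := fun t ht =>
    hrg₁ (γ₁ t) ⟨t, rfl⟩ fun h => ht (hinj₁ (h.trans h0₁.symm))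
  have hin₂ : ∀ t : unitInterval, t ≠ 0 → γ₂ t ∈ D₂.carrier := fun t ht =>
    hrg₂ (γ₂ t) ⟨t, rfl⟩ fun h => ht (hinj₂ (h.trans h0₂.symm))
  -- Step 1: the carriers agree
  have hU : D₁.carrier \ γ₁.range = D₂.carrier \ γ₂.range := by
    rw [← ConfigRigidity.remainingDomain_eq hArc hinj₁ h0₁ hin₁,
      ← ConfigRigidity.remainingDomain_eq hArc hinj₂ h0₂ hin₂]
    exact hrem
  have hcl : closure D₁.carrier = closure D₂.carrier := by
    rw [← ConfigRigidity.closure_sdiff_range_eq D₁.isOpen hinj₁, hU,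
      ConfigRigidity.closure_sdiff_range_eq D₂.isOpen hinj₂]
  have hcar : D₁.carrier = D₂.carrier := by
    rw [← JordanDomain.interior_closure_carrier D₁.toJordanDomain, hcl,
      JordanDomain.interior_closure_carrier D₂.toJordanDomain]
  -- Step 2: the parts of the arcs inside the common carrier agree
  have hS : D₁.carrier ∩ γ₁.range = D₁.carrier ∩ γ₂.range := by
    rw [← Set.sdiff_sdiff_right_self, hU, hcar, Set.sdiff_sdiff_right_self]
  -- Step 3: the starting points agree (`γ₂ 0` is a frontier point of the carrier on `K₁`)
  have ha₂ : γ₂ 0 ∈ γ₁.range := by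
    have h1 : γ₂.range \ {γ₂ 0} ⊆ D₁.carrier ∩ γ₁.range := by
      rw [hS, hcar]
      rintro z ⟨⟨t, rfl⟩, hz⟩
      refine ⟨hin₂ t fun h => hz ?_, t, rfl⟩
      rw [h]
      exact mem_singleton _
    exact closure_minimal (h1.trans inter_subset_right) γ₁.isCompact_range.isClosed
      (ConfigRigidity.apply_zero_mem_closure hinj₂)
  have h00 : γ₂ 0 = γ₁ 0 := by
    obtain ⟨t, ht⟩ := ha₂
    by_cases h : t = 0
    · rw [← ht, h]
    · exfalso
      have hfr : γ₂ 0 ∈ frontier D₁.carrier := by rw [hcar, h0₂]; exact D₂.pt_mem_frontier 0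
      rw [← ht] at hfr
      exact ConfigRigidity.notMem_frontier (hin₁ t h) hfr
  have hpt0 : D₁.pt 0 = D₂.pt 0 := by rw [← h0₁, ← h0₂, h00]
  -- Step 4: the traces agree
  have hK : γ₁.range = γ₂.range := by
    have e₁ := ConfigRigidity.range_eq_inter_union hin₁
    have e₂ := ConfigRigidity.range_eq_inter_union hin₂
    rw [hS, ← h00] at e₁
    rw [← hcar] at e₂
    exact e₁.trans e₂.symm
  -- Step 5: the classes agree, through the increasing homeomorphism `φ = γ₂⁻¹ ∘ γ₁`
  have hemb₂ : IsClosedEmbedding γ₂ := γ₂.continuous.isClosedEmbedding hinj₂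
  have hex : ∀ t, ∃ s, γ₂ s = γ₁ t := fun t => by
    show γ₁ t ∈ γ₂.range
    rw [← hK]
    exact ⟨t, rfl⟩
  choose φ hφ using hex
  have hφc : Continuous φ := by
    rw [hemb₂.continuous_iff, show γ₂ ∘ φ = γ₁ from funext hφ]
    exact γ₁.continuous
  have hφi : Function.Injective φ := fun s t h => hinj₁ (by rw [← hφ s, ← hφ t, h])
  have hφs : Function.Surjective φ := fun s => by
    obtain ⟨t, ht⟩ : γ₂ s ∈ γ₁.range := by rw [hK]; exact ⟨s, rfl⟩
    exact ⟨t, hinj₂ (by rw [hφ t]; exact ht)⟩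
  have hφ0 : φ 0 = 0 := hinj₂ (by rw [hφ 0, h00])
  have hmono : StrictMono φ := by
    refine hφc.strictMono_of_inj_boundedOrder ?_ hφi
    have hb : (⊥ : unitInterval) = 0 := le_antisymm bot_le unitInterval.nonneg'
    rw [hb, hφ0]
    exact unitInterval.nonneg'
  obtain ⟨ψ, hψ⟩ : ∃ ψ : unitInterval ≃o unitInterval, ∀ t, ψ t = φ t :=
    ⟨StrictMono.orderIsoOfSurjective φ hmono hφs, fun t =>
      congrFun (StrictMono.coe_orderIsoOfSurjective φ hmono hφs) t⟩
  have hγ : γ₁ = γ₂.reparam ψ :=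
    DFunLike.ext _ _ fun t => by rw [Curve.reparam_apply, hψ t]; exact (hφ t).symm
  refine ⟨hcar, hpt0, ?_⟩
  rw [hγ, CurveClass.mk_reparam]

end Summit.CriticalPhenomena.SAWScalingLimit.Theorems.AxiomsOfLimitMarkov
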